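import Summits.RiemannHypothesis.RiemannHypothesis.Theorems.EarlyAppointmentsRemainder0XiFarAbelSkeleton
import Summits.RiemannHypothesis.RiemannHypothesis.Theorems.EarlyAppointmentsRemainder0XiAbelLowSide
import Summits.RiemannHypothesis.RiemannHypothesis.Theorems.EarlyAppointmentsRemainder0XiAbelHighSide
import Summits.RiemannHypothesis.RiemannHypothesis.Theorems.EarlyAppointmentsRemainder0XiAbelMainNumerics
import Summits.RiemannHypothesis.RiemannHypothesis.Theorems.EarlyAppointmentsRemainder0XiFarLogKernelLogDecomp

/-!
# ⟨24730⟩ ρ2 v4 — LEAF 2 CLOSED: `abelMainLeaf_of (K) (ha : 0.03105 ≤ K.a) (hb : 0.03 ≤ K.b) : AbelMainLeaf K`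

C4 «kernel desk» rh-idea-6 g31, director (CA406)(d)/(CA419); constants from C3 g41's table `K4C` (RESULT-17:
`a = 3105/100000`, `b = 3/100`; also `K4W`: `a = 33/1000`, `b = 5/100`).  SUPPORT module for crux r3 `Remainder0Xi`
(stmt-RiemannHypothesis-24730), line `rho2_v4`, stub `stub_farAbel4`: it discharges the hypothesis `hA : AbelMainLeaf K` of
…FarAbelSkeleton `farAbel4_of_leaves` / …LedgerLeaf4KTables `farAbel4_of_three_leaves_K4C`.  Fully proved, standard axioms.

LEAF 2 (`AbelMainLeaf K`): for `γ > T_PT`, `|x − γ| ≤ 67.5`, `ε > 0`, eventually in the truncation height `T`,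
`|farHeightSum x T − mainIntegral x| ≤ K.a·log(γ/2π) + K.b + ε`, where `farHeightSum x T = Σᶠ_{far zeros, Re ρ ≤ T} m_ρ·2x/(x² − Re ρ²)`
and `mainIntegral x = (1/2π)(∫_{14}^{x−67.5} + ∫_{(x+67.5, ∞)}) log(t/2π)·2x/(x² − t²) dt` (tree …FarLogKernelBasics).
Proof.  §1 the upper main integrand `f_x(t) = log(t/2π)·2x/(x² − t²)` is integrable on `(x + 67.5, ∞)` — by the substitution
`t = x v` from the tree's `v`-space facts `integrableOn_log_div_Ioi` (…FarLogKernelLogDecomp) and `integrableOn_inv_one_sub_sq_Ioi`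
(…UpperIntegralFTC) via `MeasureTheory.integrableOn_Ioi_comp_mul_left_iff` — so `∫_{x+67.5}^{T} f → ∫_{(x+67.5,∞)} f`
(`intervalIntegral_tendsto_integral_Ioi`).  §2 the δ-DEVICE: the zeros with height in `(a − 1, a]`, `a = x + 67.5`, are finitely
many (…HeightSumAbel `heightBox_finite`), so some `δ ∈ (0, 1/100]` has NO zero height in `(a − δ, a)` (`Finset.max'`), whence the
closed far window `[a, T]` equals the half-open window `(a − δ, T]` and no boundary counting is needed.  §3 split the far sum
(…HeightSumAbel `finsum_farBox_split`) into the lower window `(0, x − 67.5]` — compared with the lower main integral by …AbelLowSide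
`lowHalf_bound` — and the upper window `(T₀, T]`, `T₀ = a − δ`, re-indexed by zeta zeros (`finsum_heights_eq_sum_zerosBetween`,
`2x/(x² − t²) = −φ↑(t)`) and compared with `∫_{T₀}^{T} φ↑ log(t/2π)/(2π)` by …AbelHighSide `highSide_tendsto` (BPT 2021 Thm 2),
the limit bounded by `abs_Fup_le` + `integral_phiUp_div_le`; the sliver `∫_{T₀}^{a}` costs `≤ φ↑(T₀)·log(a/2π)·δ`
(`norm_integral_le_of_norm_le_const`).  §4 everything is pre-divided by `2π` and the ledger closes by `linarith` against the
numeric inequality …AbelMainNumerics `leaf2Bound_le` (`≤ 0.03105·L + 0.03`, margin `0.0075` at `L = 26`).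
* ★★ `abelMainLeaf_of (K : LeafConsts) (ha : 3105/100000 ≤ K.a) (hb : 3/100 ≤ K.b) : AbelMainLeaf K`.
With …KernelShiftLeafClose `kernelShiftLeaf_of` (leaf 1), …NearPartnerLeaf `nearPartnerLeaf_of` (leaf 3) and C3's
`farAbel4_of_three_leaves_K4C` (leaf 4 = the K-table ledger) this closes `stub_farAbel4 : FarAbel4` of line rho2_v4.
Nothing here bears on the truth of RH; RH is not proved; 24730 OPEN until the chain lands and the lead closes the crux.
-/

noncomputable section

set_option linter.dupNamespace false

open Literature.NumberTheory.LFunctions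

namespace Summit.RiemannHypothesis.RiemannHypothesis.Theorems.EarlyAppointmentsRemainder0Xi.AbelMainLeafClose

open Set MeasureTheory Real Filter Topology
open Literature.NumberTheory.LFunctions.SchoenfeldBound (zerosBetween)
open Summit.RiemannHypothesis.RiemannHypothesis.Cruxes.Remainder0Xi.Rho2V2
  (T_PT boxHalfWidth lowStart mainIntegral integrableOn_log_div_Ioi)
open Summit.RiemannHypothesis.RiemannHypothesis.Theorems.EarlyAppointmentsRemainder0Xi.UpperIntegral
  (integrableOn_inv_one_sub_sq_Ioi)
open Summit.RiemannHypothesis.RiemannHypothesis.Theorems.EarlyAppointmentsRemainder0Xi.FarAbelSkeleton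
open Summit.RiemannHypothesis.RiemannHypothesis.Theorems.EarlyAppointmentsRemainder0Xi.HeightSumAbel
open Summit.RiemannHypothesis.RiemannHypothesis.Theorems.EarlyAppointmentsRemainder0Xi.AbelLowSide
open Summit.RiemannHypothesis.RiemannHypothesis.Theorems.EarlyAppointmentsRemainder0Xi.AbelHighSide
open Summit.RiemannHypothesis.RiemannHypothesis.Theorems.EarlyAppointmentsRemainder0Xi.AbelMainNumerics

/-! ## §1 The upper main integrand is integrable on `(x + 67.5, ∞)`; the truncated integrals converge -/

/-- (K) `t ↦ log(t/2π)·2x/(x² − t²)` is integrable on `(x + 67.5, ∞)` (`x > 0`): substitution `t = xv` from the tree's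
`∫ log v/(1 − v²)` and `∫ 1/(1 − v²)` integrability on `(1 + 67.5/x, ∞)`. -/
theorem integrableOn_upper {x : ℝ} (hx : 0 < x) :
    IntegrableOn (fun t : ℝ ↦ Real.log (t / (2 * π)) * (2 * x / (x ^ 2 - t ^ 2))) (Ioi (x + boxHalfWidth)) := by
  have hB : boxHalfWidth = 135 / 2 := rfl
  have hxne : x ≠ 0 := hx.ne'
  have hh : (0 : ℝ) < boxHalfWidth := by rw [hB]; norm_num
  have hc : (1 : ℝ) < 1 + boxHalfWidth / x := by
    have : 0 < boxHalfWidth / x := div_pos hh hx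
    linarith
  have h1 : IntegrableOn (fun v : ℝ ↦ Real.log v / (1 - v ^ 2)) (Ioi (1 + boxHalfWidth / x)) :=
    integrableOn_log_div_Ioi.mono_set (Ioi_subset_Ioi hc.le)
  have h2 : IntegrableOn (fun v : ℝ ↦ (1 : ℝ) / (1 - v ^ 2)) (Ioi (1 + boxHalfWidth / x)) :=
    integrableOn_inv_one_sub_sq_Ioi hc
  have h3 : IntegrableOn
      (fun v : ℝ ↦ 2 / x * (Real.log v / (1 - v ^ 2) + Real.log (x / (2 * π)) * ((1 : ℝ) / (1 - v ^ 2))))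
      (Ioi (1 + boxHalfWidth / x)) :=
    (h1.fun_add (h2.const_mul _)).const_mul _
  have h4 : IntegrableOn (fun v : ℝ ↦ Real.log (x * v / (2 * π)) * (2 * x / (x ^ 2 - (x * v) ^ 2)))
      (Ioi (1 + boxHalfWidth / x)) := by
    refine h3.congr_fun (fun v hv ↦ ?_) measurableSet_Ioi
    have hv1 : 1 < v := lt_trans hc hv
    have hv0 : 0 < v := by linarith
    have hvne : 1 - v ^ 2 ≠ 0 := by nlinarith
    have hxv : x ^ 2 - (x * v) ^ 2 = x ^ 2 * (1 - v ^ 2) := by ring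
    have hlog : Real.log (x * v / (2 * π)) = Real.log v + Real.log (x / (2 * π)) := by
      rw [show x * v / (2 * π) = v * (x / (2 * π)) by ring, Real.log_mul hv0.ne' (by positivity)]
    rw [hlog, hxv]
    field_simp
  have h5 := (integrableOn_Ioi_comp_mul_left_iff
    (fun t : ℝ ↦ Real.log (t / (2 * π)) * (2 * x / (x ^ 2 - t ^ 2))) (1 + boxHalfWidth / x) hx).1 h4
  have e : x * (1 + boxHalfWidth / x) = x + boxHalfWidth := by field_simp
  rw [e] at h5
  exact h5

/-- (K) `∫_{x+67.5}^{T} f_x → ∫_{(x+67.5, ∞)} f_x` as `T → ∞`. -/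
theorem upper_tendsto {x : ℝ} (hx : 0 < x) :
    Tendsto (fun T : ℝ ↦ ∫ t in (x + boxHalfWidth)..T, Real.log (t / (2 * π)) * (2 * x / (x ^ 2 - t ^ 2))) atTop
      (𝓝 (∫ t in Ioi (x + boxHalfWidth), Real.log (t / (2 * π)) * (2 * x / (x ^ 2 - t ^ 2)))) :=
  intervalIntegral_tendsto_integral_Ioi _ (integrableOn_upper hx) tendsto_id

/-- (K) continuity of `f_x` on `[T₀, ∞)` for `0 < x < T₀`, and interval integrability there. -/
theorem continuousOn_f {x T₀ : ℝ} (hx : 0 < x) (hxT : x < T₀) :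
    ContinuousOn (fun t : ℝ ↦ Real.log (t / (2 * π)) * (2 * x / (x ^ 2 - t ^ 2))) (Ici T₀) := by
  refine ContinuousOn.mul ?_ ?_
  · refine ContinuousOn.log (by fun_prop) fun t ht ↦ ?_
    have : T₀ ≤ t := ht
    exact (div_pos (by linarith) (by positivity)).ne'
  · refine ContinuousOn.div continuousOn_const (by fun_prop) fun t ht ↦ ?_
    have : T₀ ≤ t := ht
    exact ne_of_lt (by nlinarith)

/-- The Abel integrand `log(t/2π)·(2x/(x² − t²))` is interval-integrable on any `[a, b] ⊂ [T₀, ∞)` with `0 < x < T₀`. -/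
theorem intervalIntegrable_f {x T₀ a b : ℝ} (hx : 0 < x) (hxT : x < T₀) (ha : T₀ ≤ a) (hb : T₀ ≤ b) :
    IntervalIntegrable (fun t : ℝ ↦ Real.log (t / (2 * π)) * (2 * x / (x ^ 2 - t ^ 2))) volume a b := by
  refine ((continuousOn_f hx hxT).mono fun t ht ↦ ?_).intervalIntegrable
  simp only [Set.mem_Ici]
  rcases Set.mem_uIcc.1 ht with h | h
  · exact le_trans ha h.1
  · exact le_trans hb h.1

/-- (K) the sliver: `|∫_{T₀}^{a} f_x| ≤ φ↑(T₀)·log(a/2π)·|a − T₀|` for `2π ≤ T₀ ≤ a`, `0 < x < T₀` (`|f_x| = φ↑·log(·/2π)` is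
a product of a decreasing and an increasing nonnegative factor). -/
theorem sliver_le {x T₀ a : ℝ} (hx : 0 < x) (hxT : x < T₀) (hTa : T₀ ≤ a) (h2π : 2 * π ≤ T₀) :
    |∫ t in T₀..a, Real.log (t / (2 * π)) * (2 * x / (x ^ 2 - t ^ 2))|
      ≤ 2 * x / (T₀ ^ 2 - x ^ 2) * Real.log (a / (2 * π)) * |a - T₀| := by
  have h := intervalIntegral.norm_integral_le_of_norm_le_const (a := T₀) (b := a)
    (C := 2 * x / (T₀ ^ 2 - x ^ 2) * Real.log (a / (2 * π)))
    (f := fun t : ℝ ↦ Real.log (t / (2 * π)) * (2 * x / (x ^ 2 - t ^ 2))) ?_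
  · simpa only [Real.norm_eq_abs] using h
  · intro t ht
    rw [Set.uIoc_of_le hTa] at ht
    obtain ⟨ht1, ht2⟩ := ht
    have h2π0 : 0 < 2 * π := by positivity
    have ht0 : 0 < t := by linarith
    have hlog0 : 0 ≤ Real.log (t / (2 * π)) :=
      Real.log_nonneg (by rw [le_div_iff₀ h2π0]; linarith)
    have hloga : Real.log (t / (2 * π)) ≤ Real.log (a / (2 * π)) :=
      Real.log_le_log (by positivity) (by rw [div_le_div_iff_of_pos_right h2π0]; exact ht2)
    have hden : 0 < t ^ 2 - x ^ 2 := by nlinarith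
    have hdenT : 0 < T₀ ^ 2 - x ^ 2 := by nlinarith
    have hk : 2 * x / (t ^ 2 - x ^ 2) ≤ 2 * x / (T₀ ^ 2 - x ^ 2) :=
      div_le_div_of_nonneg_left (by linarith) hdenT (by nlinarith)
    have hk0 : 0 ≤ 2 * x / (t ^ 2 - x ^ 2) := div_nonneg (by linarith) hden.le
    have e : Real.log (t / (2 * π)) * (2 * x / (x ^ 2 - t ^ 2)) = -(Real.log (t / (2 * π)) * (2 * x / (t ^ 2 - x ^ 2))) := by
      rw [← neg_sub (t ^ 2) (x ^ 2), div_neg]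
      ring
    rw [Real.norm_eq_abs, e, abs_neg, abs_of_nonneg (mul_nonneg hlog0 hk0)]
    calc Real.log (t / (2 * π)) * (2 * x / (t ^ 2 - x ^ 2))
        ≤ Real.log (a / (2 * π)) * (2 * x / (T₀ ^ 2 - x ^ 2)) := mul_le_mul hloga hk hk0 (le_trans hlog0 hloga)
      _ = 2 * x / (T₀ ^ 2 - x ^ 2) * Real.log (a / (2 * π)) := by ring

/-! ## §2 The δ-device: a zero-free sliver below the upper edge -/

/-- (K) for every height `a` there is `δ ∈ (0, 1/100]` such that no zero of `Ξ` has height in the open sliver `(a − δ, a)`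
(the zeros with height in `(a − 1, a]` are finitely many). -/
theorem exists_gap (a : ℝ) :
    ∃ δ : ℝ, 0 < δ ∧ δ ≤ 1 / 100 ∧ ∀ ρ : ℂ, riemannXiUpper ρ = 0 → a - δ < ρ.re → a ≤ ρ.re := by
  classical
  have hfin : (heightBox (a - 1) a).Finite := heightBox_finite _ _
  let H : Finset ℝ := (hfin.toFinset.filter fun ρ ↦ ρ.re < a).image fun ρ ↦ ρ.re
  let S : Finset ℝ := insert (a - 1 / 100) H
  have hSne : S.Nonempty := Finset.insert_nonempty _ _
  have hlt : ∀ t ∈ S, t < a := by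
    intro t ht
    rcases Finset.mem_insert.1 ht with rfl | ht'
    · linarith
    · obtain ⟨ρ, hρ, rfl⟩ := Finset.mem_image.1 ht'
      exact (Finset.mem_filter.1 hρ).2
  have hm_lt : S.max' hSne < a := hlt _ (Finset.max'_mem S hSne)
  have hm_ge : a - 1 / 100 ≤ S.max' hSne := Finset.le_max' S _ (Finset.mem_insert_self _ _)
  refine ⟨a - S.max' hSne, by linarith, by linarith, fun ρ hρ h1 ↦ ?_⟩
  by_cases h2 : ρ.re < a
  swap
  · exact not_lt.1 h2
  have hmem : ρ.re ∈ S := by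
    refine Finset.mem_insert_of_mem (Finset.mem_image.2 ⟨ρ, ?_, rfl⟩)
    exact Finset.mem_filter.2 ⟨hfin.mem_toFinset.2 ⟨hρ, by linarith, h2.le⟩, h2⟩
  have hle : ρ.re ≤ S.max' hSne := Finset.le_max' S _ hmem
  linarith

/-- (K) under the gap, the CLOSED upper window `[a, T]` of the far box is the HALF-OPEN window `(a − δ, T]`. -/
theorem closedHeightBox_eq_heightBox {a δ T : ℝ} (hδ : 0 < δ)
    (hgap : ∀ ρ : ℂ, riemannXiUpper ρ = 0 → a - δ < ρ.re → a ≤ ρ.re) :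
    closedHeightBox a T = heightBox (a - δ) T := by
  ext ρ
  simp only [closedHeightBox, heightBox, Set.mem_setOf_eq]
  constructor
  · rintro ⟨h0, h1, h2⟩
    exact ⟨h0, by linarith, h2⟩
  · rintro ⟨h0, h1, h2⟩
    exact ⟨h0, hgap ρ h0 h1, h2⟩

/-! ## §3 Splitting and re-indexing the far height sum -/

/-- (K) for `T ≥ x + 67.5` (and `x ≥ 67.5`) the far height sum is the lower window sum plus the closed upper window sum. -/
theorem farHeightSum_split {x T : ℝ} (hxb : 0 ≤ x - boxHalfWidth) (hT : x + boxHalfWidth ≤ T) :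
    farHeightSum x T =
      (∑ᶠ ρ ∈ heightBox 0 (x - boxHalfWidth),
          ((analyticOrderAt riemannXiUpper ρ).toNat : ℝ) * (2 * x / (x ^ 2 - ρ.re ^ 2)))
      + ∑ᶠ ρ ∈ closedHeightBox (x + boxHalfWidth) T,
          ((analyticOrderAt riemannXiUpper ρ).toNat : ℝ) * (2 * x / (x ^ 2 - ρ.re ^ 2)) := by
  have hh : (0 : ℝ) < boxHalfWidth := by rw [show boxHalfWidth = 135 / 2 from rfl]; norm_num
  unfold farHeightSum farBoxAt
  exact finsum_farBox_split hh hxb hT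
    (fun ρ : ℂ ↦ ((analyticOrderAt riemannXiUpper ρ).toNat : ℝ) * (2 * x / (x ^ 2 - ρ.re ^ 2)))

/-- (K) the half-open upper window sum, re-indexed by the zeta zeros `1/2 + iρ` with `Im ∈ (T₀, T]`, is MINUS the
`φ↑`-sum of …AbelHighSide (`2x/(x² − t²) = −φ↑_x(t)`). -/
theorem high_eq_neg {x T₀ T : ℝ} (hT₀ : 0 ≤ T₀) :
    ∑ᶠ ρ ∈ heightBox T₀ T, ((analyticOrderAt riemannXiUpper ρ).toNat : ℝ) * (2 * x / (x ^ 2 - ρ.re ^ 2)) =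
      -∑ ρ ∈ zerosBetween T₀ T, (riemannZetaZeroOrder ρ : ℝ) * phiUp x ρ.im := by
  have h := finsum_heights_eq_sum_zerosBetween (b := T) hT₀ (phiDn x)
  simp only [phiDn] at h
  rw [h, ← Finset.sum_neg_distrib]
  refine Finset.sum_congr rfl fun ρ _ ↦ ?_
  simp only [phiUp]
  rw [← neg_sub (ρ.im ^ 2) (x ^ 2), div_neg]
  ring

/-! ## §4 Assembly: LEAF 2 -/

/-- ★ (K) for `γ > T_PT`, `|x − γ| ≤ 67.5`, `ε > 0`: eventually in `T`,
`|farHeightSum x T − mainIntegral x| ≤ 0.03105·log(γ/2π) + 0.03 + ε`. -/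
theorem abelMain_eventually {γ x ε : ℝ} (hγ : T_PT < γ) (hxγ : |x - γ| ≤ boxHalfWidth) (hε : 0 < ε) :
    ∀ᶠ T : ℝ in atTop,
      |farHeightSum x T - mainIntegral x| ≤ 3105 / 100000 * Real.log (γ / (2 * Real.pi)) + 3 / 100 + ε := by
  have hT : T_PT = 3000175332800 := rfl
  have hB : boxHalfWidth = 135 / 2 := rfl
  have hγ' : (3000175332800 : ℝ) < γ := hγ
  obtain ⟨hx1, hx2⟩ := abs_le.1 hxγ
  rw [hB] at hx1 hx2
  have hx0 : 0 < x := by linarith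
  have hx' : T_PT - boxHalfWidth ≤ x := by rw [hT, hB]; linarith
  have hxb : 0 ≤ x - boxHalfWidth := by rw [hB]; linarith
  have h2π0 : 0 < 2 * π := by positivity
  have h2π1 : (1 : ℝ) ≤ 2 * π := by linarith [Real.pi_gt_three]
  -- the zero-free sliver below the upper edge `a = x + 67.5`; the Abel start `T₀ = a − δ`
  obtain ⟨δ, hδ0, hδ1, hgap⟩ := exists_gap (x + boxHalfWidth)
  have hxT : x < x + boxHalfWidth - δ := by rw [hB]; linarith
  have h3 : (3 : ℝ) ≤ x + boxHalfWidth - δ := by rw [hB]; linarith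
  have he : Real.exp 1 ≤ x + boxHalfWidth - δ := by
    have := Real.exp_one_lt_d9
    rw [hB]
    linarith
  have h2πT : 2 * π ≤ x + boxHalfWidth - δ := by
    have := Real.pi_lt_four
    rw [hB]
    linarith
  have hT00 : (0 : ℝ) ≤ x + boxHalfWidth - δ := by linarith
  have h1 : (1 : ℝ) ≤ (x + boxHalfWidth - δ) ^ 2 - x ^ 2 := by rw [hB]; nlinarith
  have hTa : x + boxHalfWidth - δ ≤ x + boxHalfWidth := by linarith
  have eδ : |x + boxHalfWidth - (x + boxHalfWidth - δ)| = δ := by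
    rw [show x + boxHalfWidth - (x + boxHalfWidth - δ) = δ by ring, abs_of_pos hδ0]
  -- the analytic inputs
  have htend₁ := highSide_tendsto hx0 hxT h3
  have htend₂ := upper_tendsto (x := x) hx0
  have hFup : |Fup x (x + boxHalfWidth - δ)|
      ≤ 2 * (0.1038 * Real.log (x + boxHalfWidth - δ) + 0.2573 * Real.log (Real.log (x + boxHalfWidth - δ)) + 10.2425)
          * (2 * x / ((x + boxHalfWidth - δ) ^ 2 - x ^ 2))
        + (0.1038 + 0.2573 / Real.log (x + boxHalfWidth - δ))
          * ∫ t in Ioi (x + boxHalfWidth - δ), phiUp x t / t :=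
    abs_Fup_le hx0 hxT h3 he
  obtain ⟨hF1, hF2⟩ := abs_le.1 hFup
  have htail := integral_phiUp_div_le hx0 hxT h1
  have htail' := mul_le_mul_of_nonneg_left htail (coef_nonneg h3)
  have hlow : |∑ᶠ ρ ∈ heightBox 0 (x - boxHalfWidth),
        ((analyticOrderAt riemannXiUpper ρ).toNat : ℝ) * (2 * x / (x ^ 2 - ρ.re ^ 2))
        - (∫ t in lowStart..(x - boxHalfWidth), 2 * x / (x ^ 2 - t ^ 2) * Real.log (t / (2 * π))) / (2 * π)|
      ≤ (0.1038 * Real.log (x - boxHalfWidth) + 0.2573 * Real.log (Real.log (x - boxHalfWidth)) + 10.2425)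
          * (2 * (2 * x / (x ^ 2 - (x - boxHalfWidth) ^ 2))) + 1 / 10 ^ 9 :=
    lowHalf_bound hx'
  obtain ⟨hL1, hL2⟩ := abs_le.1 hlow
  have hsl : |∫ t in (x + boxHalfWidth - δ)..(x + boxHalfWidth), Real.log (t / (2 * π)) * (2 * x / (x ^ 2 - t ^ 2))|
      ≤ 2 * x / ((x + boxHalfWidth - δ) ^ 2 - x ^ 2) * Real.log ((x + boxHalfWidth) / (2 * π)) * δ := by
    have := sliver_le hx0 hxT hTa h2πT
    rwa [eδ] at this
  obtain ⟨hP1, hP2⟩ := abs_le.1 hsl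
  have hP1' := div_le_div_of_nonneg_right hP1 h2π0.le
  have hP2' := div_le_div_of_nonneg_right hP2 h2π0.le
  rw [neg_div] at hP1'
  have hnum := leaf2Bound_le hγ hxγ hδ0 hδ1
  unfold leaf2Bound at hnum
  have hε4 : 0 < ε / 4 := by linarith
  filter_upwards [htend₁.eventually (eventually_lt_nhds (show Fup x (x + boxHalfWidth - δ)
        < Fup x (x + boxHalfWidth - δ) + ε / 4 by linarith)),
    htend₁.eventually (eventually_gt_nhds (show Fup x (x + boxHalfWidth - δ) - ε / 4
        < Fup x (x + boxHalfWidth - δ) by linarith)),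
    htend₂.eventually (eventually_lt_nhds
      (show (∫ t in Ioi (x + boxHalfWidth), Real.log (t / (2 * π)) * (2 * x / (x ^ 2 - t ^ 2)))
        < (∫ t in Ioi (x + boxHalfWidth), Real.log (t / (2 * π)) * (2 * x / (x ^ 2 - t ^ 2))) + ε / 4 by linarith)),
    htend₂.eventually (eventually_gt_nhds
      (show (∫ t in Ioi (x + boxHalfWidth), Real.log (t / (2 * π)) * (2 * x / (x ^ 2 - t ^ 2))) - ε / 4
        < (∫ t in Ioi (x + boxHalfWidth), Real.log (t / (2 * π)) * (2 * x / (x ^ 2 - t ^ 2))) by linarith)),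
    eventually_ge_atTop (x + boxHalfWidth)] with T hS1 hS2 hJ1 hJ2 hTge
  -- split the far sum; the closed upper window is the half-open one from `T₀`; re-index it
  rw [farHeightSum_split hxb hTge, closedHeightBox_eq_heightBox hδ0 hgap, high_eq_neg hT00]
  -- the truncated upper integrals: `∫_{T₀}^{T} φ↑·log = −(∫_{T₀}^{a} f + ∫_{a}^{T} f)`
  have hadd := intervalIntegral.integral_add_adjacent_intervals
    (intervalIntegrable_f hx0 hxT le_rfl hTa) (intervalIntegrable_f hx0 hxT hTa (le_trans hTa hTge))
  have ef : (∫ t in (x + boxHalfWidth - δ)..T, phiUp x t * Real.log (t / (2 * π)))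
      = -∫ t in (x + boxHalfWidth - δ)..T, Real.log (t / (2 * π)) * (2 * x / (x ^ 2 - t ^ 2)) := by
    rw [← intervalIntegral.integral_neg]
    refine intervalIntegral.integral_congr fun t _ ↦ ?_
    simp only [phiUp]
    rw [← neg_sub (t ^ 2) (x ^ 2), div_neg]
    ring
  have eI : (∫ t in (x + boxHalfWidth - δ)..T, phiUp x t * Real.log (t / (2 * π))) / (2 * π)
      = -((∫ t in (x + boxHalfWidth - δ)..(x + boxHalfWidth), Real.log (t / (2 * π)) * (2 * x / (x ^ 2 - t ^ 2))) / (2 * π))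
        - (∫ t in (x + boxHalfWidth)..T, Real.log (t / (2 * π)) * (2 * x / (x ^ 2 - t ^ 2))) / (2 * π) := by
    rw [ef, ← hadd]
    ring
  -- the tail of the improper upper integral, pre-divided by `2π ≥ 1`
  have hQB : |(∫ t in (x + boxHalfWidth)..T, Real.log (t / (2 * π)) * (2 * x / (x ^ 2 - t ^ 2)))
      - ∫ t in Ioi (x + boxHalfWidth), Real.log (t / (2 * π)) * (2 * x / (x ^ 2 - t ^ 2))| ≤ ε / 4 :=
    abs_le.2 ⟨by linarith, by linarith⟩
  have hQ : |(∫ t in (x + boxHalfWidth)..T, Real.log (t / (2 * π)) * (2 * x / (x ^ 2 - t ^ 2)))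
      - ∫ t in Ioi (x + boxHalfWidth), Real.log (t / (2 * π)) * (2 * x / (x ^ 2 - t ^ 2))| / (2 * π) ≤ ε / 4 :=
    (div_le_self (abs_nonneg _) h2π1).trans hQB
  have hQ1 := (div_le_div_of_nonneg_right (le_abs_self
    ((∫ t in (x + boxHalfWidth)..T, Real.log (t / (2 * π)) * (2 * x / (x ^ 2 - t ^ 2)))
      - ∫ t in Ioi (x + boxHalfWidth), Real.log (t / (2 * π)) * (2 * x / (x ^ 2 - t ^ 2)))) h2π0.le).trans hQ
  have hQ2 := (div_le_div_of_nonneg_right (neg_le_abs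
    ((∫ t in (x + boxHalfWidth)..T, Real.log (t / (2 * π)) * (2 * x / (x ^ 2 - t ^ 2)))
      - ∫ t in Ioi (x + boxHalfWidth), Real.log (t / (2 * π)) * (2 * x / (x ^ 2 - t ^ 2)))) h2π0.le).trans hQ
  rw [sub_div] at hQ1
  rw [neg_sub, sub_div] at hQ2
  -- the main integral, pre-divided
  have eA : (∫ t in lowStart..(x - boxHalfWidth), Real.log (t / (2 * Real.pi)) * (2 * x / (x ^ 2 - t ^ 2)))
      = ∫ t in lowStart..(x - boxHalfWidth), 2 * x / (x ^ 2 - t ^ 2) * Real.log (t / (2 * π)) := by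
    refine intervalIntegral.integral_congr fun t _ ↦ ?_
    ring
  have eM : mainIntegral x
      = (∫ t in lowStart..(x - boxHalfWidth), 2 * x / (x ^ 2 - t ^ 2) * Real.log (t / (2 * π))) / (2 * π)
        + (∫ t in Ioi (x + boxHalfWidth), Real.log (t / (2 * π)) * (2 * x / (x ^ 2 - t ^ 2))) / (2 * π) := by
    unfold mainIntegral
    rw [eA]
    ring
  rw [eM, abs_le]
  constructor <;> linarith

/-- ★★ (K) **LEAF 2 of `FarAbel4` CLOSED**: `AbelMainLeaf K` for every table of constants with `K.a ≥ 0.03105`, `K.b ≥ 0.03`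
(C3 g41's `K4C`: `a = 3105/100000`, `b = 3/100`; `K4W`: `a = 33/1000`, `b = 5/100`). -/
theorem abelMainLeaf_of (K : LeafConsts) (ha : 3105 / 100000 ≤ K.a) (hb : 3 / 100 ≤ K.b) : AbelMainLeaf K := by
  intro γ hγ x hx ε hε
  have hL : 0 ≤ Real.log (γ / (2 * Real.pi)) := by linarith [RegistryForm.log_div_twoPi_ge hγ]
  have haL := mul_le_mul_of_nonneg_right ha hL
  filter_upwards [abelMain_eventually hγ hx hε] with T hT
  linarith

end Summit.RiemannHypothesis.RiemannHypothesis.Theorems.EarlyAppointmentsRemainder0Xi.AbelMainLeafClose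

end
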